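/- Copyright: the b2b-balaban cell (near-miss cell 7), T⁴-continuum fan-out; row NE7b ROUND-2 swarm, seat
t4-ne7b-formalise-leaf-02 (gen 12) (row S12o «CONCAVE ENTROPY REPAIR», part (iv) «pinned ∕ headline v1.2 over END v3.2′»,
file 2 of 2; owner's rulings R-OWNER-23-15 (2) ∕ division of labour, journal l.17861 ∕ l.17953).  Released under the licence
of the surrounding project. -/
import Summits.QuantumFields.BalabanUV.T4Continuum.Support.HistoryRealiseCellsRunPinnedT3bPTwin
import Summits.QuantumFields.BalabanUV.T4Continuum.Support.HistoryRealiseCellsRunApexT3b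
import Summits.QuantumFields.BalabanUV.T4Continuum.Support.HistoryConstantsSlackT3bP

/-!
# Realised histories: THE APEX INPUT AND THE HEADLINE FROM THE COUNT ROAD OVER THE GENERIC END v3.2′ — ANY CLASS-LINEAR CONSTANT

Summits-side support leaf of the T⁴-continuum cell (rung (B)+1 on a FINITE torus only; NOT infinite volume, NOT the
mass gap, NOT the Clay statement; NOT a proof of the spine estimate NE7b).  Row S12 ∕ node A12-I of the claim table
`t4/b2b-balaban-t4-ne7b-p1/LEAVES-NE7b.md`, owner row S12o «CONCAVE ENTROPY REPAIR» (R-OWNER-23-15), part (iv) «S12i pinned ∕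
headline v1.2 over v3.2′» (leaf-02 lineage ON EVENT of part (iii), journal l.17953), file 2 of 2.  Sibling of this lineage's
v1.1 `HistoryRealiseCellsRunHeadlineT3bP` (p224237, the COUNT road's HEADLINE OF RECORD — UNCHANGED) with the pinned END
swapped: `HistoryRealiseCellsRunPinnedT3bP.hybridNE7_of_realisedDomainsRun_pinnedT3bPD` (over END v3.1′) ↦ file 1's
`HistoryRealiseCellsRunPinnedT3bPTwin.hybridNE7_of_realisedDomainsRun_pinnedT3bPD_of_twin` (over leaf-08 gen 11's GENERIC
END v3.2′ `HistoryRealiseCellsRunMultEndPDTwin`, the class-linear constant `Θ₀` a free parameter and the twin bound a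
displayed inner hypothesis).

WHAT.  §1 **`structure CountRoadWitnessT3bTwin … (Θ₀ : ℝ) (g₀) (os) (ι α π) extends CountRoadWitnessT3b D C O rr d n hn g₀ os ι α π`**
(`Type`-valued, consumed only under `Nonempty` inside a binder — exactly as `CountRoadWitnessT3b`): ONE more field,
`twin` = END v3.2′'s `htwin` at `Θ₀` written on the witness' own `K₀ T R ped liveC` (the twin bound of row S6g′ along
the run: `#S … ((ped K τ).sortR.gen c) z ≤ exp (Θ₀·bsum (fat+1) ((ped K τ).gen c) + 8∕C.E₂·totalCostT …)·((L^d)·e^4)^{partnerAges …}`).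
§2 **`hybridNE7Under_of_countRoadT3bPTwin_fsc`**: `T4ApexHybrid.HybridNE7Under D (BetaPertHyp D.βfun)` from the datum's sign
conventions, the constants-side side conditions `ThresholdOK`, `0 < μ`, κ₁∕E₀ largeness, `1 ≤ A₀`, `0 < β₀`, `F.L·β₀ ≤ 1`,
`13 ≤ n₁`, `0 < n`, ANY positive slack (`0 < θ`, `C.a + θ ≤ ½·O.γ₀·O.A₁²`), ANY `Θ₀ : ℝ` — NO stride ∕ decay ∕ `E₂`∕`E₃`
arithmetic, NO `hθJ`, NO demand — and ONE displayed hypothesis under `T4ContinuumYM4Torus.ForSmallCouplings`: «for all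
small-coupling tuned runs and all loop strings, a `CountRoadWitnessT3bTwin` at `Θ₀`»; **`hybridNE7Under_of_countRoadT3bPTwin`**
(every `γ, g > 0`), **`limit_exists_of_countRoadT3bPTwin_fsc`** ∕ **`limit_unique_of_countRoadT3bPTwin_fsc`**,
**`targets_of_countRoadT3bPTwin_fsc`** and **`continuumYM4Torus_of_countRoadT3bPTwin_fsc`** — `T4ContinuumYM4Torus.ContinuumYM4Torus D`
from the two pins `hB : B16.EndStatementBPrinted D.C`, `hβ : BetaPertHyp D.βfun` BY NAME (inside
`T4ContinuumYM4Torus.continuumYM4Torus_of_targets` only), the displayed witness hypothesis and the side conditions.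
§3 **`exists_consts_countRoadT3bPTwin`**: the constants-side antecedent is INHABITED for every positive printed `O`, every `F`,
`d`, `rr` (`n := 1`) and EVERY `Θ₀` — from leaf-08 gen 7's `HistoryConstantsSlackT3bP.END3P_consts_of_pos` BY NAME, the stride ∕
decay ∕ level conjuncts dropped.

WHY (smallness census of record, R-OWNER-23-15 (1)).  The count's class-linear constant is paid in the coupling window only
(`g₁`); the census found the tree's pointwise-linearised `ΘJ` ≈ 2.36·10²⁷ (`x_root ≈ 15.5`) against the honest concave
≈ 875 (`x_root ≈ 1.34`).  This headline is UNIFORM in `Θ₀`: every supplier of the twin bound — the tree's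
`HistoryJoinsPlacedTwin.card_S_sortR_le_exp_pow` at `Θ₀ := ΘJ d sS θc` (recovering v1.1's reading), row S12o (ii)'s concave
sibling at `Θ₀ := ΘJc …` (leaf-05 gen 10), or any later repair — instantiates the SAME theorem by filling the field `twin`;
the headline's `Prop` never changes.

HONEST READING (verbatim for headlines; c4).  `ContinuumYM4Torus D ⇐ (B) ∧ BetaPertHyp ∧ [∀ small-coupling tuned run ∀
string: CountRoadWitnessT3bTwin at Θ₀]` for ANY real `Θ₀` (+ sign conventions + INHABITED constants-side conditions), and
the witness DISPLAYS — as hypothesis shapes, none in print, none a theorem of the tree — everything `CountRoadWitnessT3b`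
displays (H3: realised pedigrees with domains, `step ≤ cutoff`, `DisjointJoins` ∕ `BoxedBirths`, realised costs, price
sentences with the discount, numerator readings; E1∕E2; the (B)-side floors ∕ sites ∕ envelopes; NE7c's `ShellWeightBound`;
NE7's `ReindexedBudget`; four summable rates) PLUS the twin bound at `Θ₀` (row S6g′'s placement-entropy inequality, which
v1.1 obtained from the tree's instance `ΘJ d sS θc` under displayed stride ∕ decay arithmetic — here it is displayed as
such, its suppliers live in rows S6g′ ∕ S12o (ii)).  The headline of record p224237 is NOT superseded; spine count 0∕9
UNCHANGED; NE7b NOT proved.  [folklore] composition by name; ONE `structure … : Type` hypothesis shape (c1: no `Prop`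
fact minted), no `def`, no `[cite:]` tag, nothing printed asserted, no constant specialised (c2∕c6), no exit ∕ socket ∕
`HistoryConstants` file touched (c3).  HONEST DEPENDENCY (cell): continuum YM on T⁴ ⇐ BetaPertH ∧ nine spine estimates
(0/9 proved); BetaPertH ⇐ (D1) ∧ (D4) ∧ CAP+tail; G-an2-4 gates asym, D1 and NE2/3/4.  This file changes none of it. -/

open Finset MeasureTheory
open Literature.MathematicalPhysics.QuantumFieldTheory.Balaban1983to89
open T4PersistenceDictionary T4PersistentHistoryCount T4BankedInduction T4PrintedShapeBanking
open T4WeightBudget T4GlobalDenominator T4LiveClassFibration T4LiveStructureGas T4LiveGasToTerms T4RecordPriceSeam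
open T4PartnerMultiplicity T4IndicatorShell T4MatchingAssembly T4MatchingClosure T4MatchingClosureSocket T4Continuum
open T4StabilitySocket T4BranchingRecordsGas T4TaggedShapeBanking T4CanonicalMenus T4RenewalChains
open Summit.QuantumFields.BalabanUV.T4Continuum.PlacementBatch
open Summit.QuantumFields.BalabanUV.T4Continuum.PlacementSkeleton
open Summit.QuantumFields.BalabanUV.T4Continuum.CountThresholdUniform
open Summit.QuantumFields.BalabanUV.T4Continuum.CountThresholdExit
open Summit.QuantumFields.BalabanUV.T4Continuum.CountSeamJunction
open Summit.QuantumFields.BalabanUV.T4Continuum.LateMergers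
open Summit.QuantumFields.BalabanUV.T4Continuum.HistoryFlow
open Summit.QuantumFields.BalabanUV.T4Continuum.HistoryRegeneration
open Summit.QuantumFields.BalabanUV.T4Continuum.HistoryTables
open Summit.QuantumFields.BalabanUV.T4Continuum.HistoryAssemblyTrees
open Summit.QuantumFields.BalabanUV.T4Continuum.HistoryAssemblyTerms
open Summit.QuantumFields.BalabanUV.T4Continuum.HistoryAssemblyPedigree
open Summit.QuantumFields.BalabanUV.T4Continuum.HistoryConstants
open Summit.QuantumFields.BalabanUV.T4Continuum.HistoryGen
open Literature.MathematicalPhysics.QuantumFieldTheory.Balaban1983to89.B13ScaleTransfer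
open Summit.QuantumFields.BalabanUV.T4Continuum.ZoneSkeleton
open Summit.QuantumFields.BalabanUV.T4Continuum.HistorySocketTH
open Summit.QuantumFields.BalabanUV.T4Continuum.HistoryCaps
open Summit.QuantumFields.BalabanUV.T4Continuum.HistoryAssemblyPrice
open Summit.QuantumFields.BalabanUV.T4Continuum.HistoryBankingLE
open Summit.QuantumFields.BalabanUV.T4Continuum.HistoryExitLE
open Summit.QuantumFields.BalabanUV.T4Continuum.HistoryAssemblyTreesLE
open Summit.QuantumFields.BalabanUV.T4Continuum.HistoryAssemblyTermsLE
open Summit.QuantumFields.BalabanUV.T4Continuum.HistoryRealise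
open Summit.QuantumFields.BalabanUV.T4Continuum.HistoryAssemblyRealiseLE
open Summit.QuantumFields.BalabanUV.T4Continuum.HistoryAssemblyMult
open Summit.QuantumFields.BalabanUV.T4Continuum.HistoryAssemblyMultKey
open Summit.QuantumFields.BalabanUV.T4Continuum.HistoryAssemblyRealiseRun
open Summit.QuantumFields.BalabanUV.T4Continuum.HistoryAssemblyRealiseMult
open Summit.QuantumFields.BalabanUV.T4Continuum.HistoryZones
open Summit.QuantumFields.BalabanUV.T4Continuum.HistoryRealiseCells
open Summit.QuantumFields.BalabanUV.T4Continuum.HistoryRealiseCellsRun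
open Summit.QuantumFields.BalabanUV.T4Continuum.HistoryAssemblyRealiseRunMult

open Summit.QuantumFields.BalabanUV.T4Continuum.HistoryRealiseCellsRunMult
open Summit.QuantumFields.BalabanUV.T4Continuum.HistoryAssemblyMultInstance
open Summit.QuantumFields.BalabanUV.T4Continuum.HistoryJoinsPlacedMember
open Summit.QuantumFields.BalabanUV.T4Continuum.PlacementSkeleton
open Summit.QuantumFields.BalabanUV.T4Continuum.HistoryJoinsPlacedMult
open Summit.QuantumFields.BalabanUV.T4Continuum.HistoryRealiseDistinct
open Summit.QuantumFields.BalabanUV.T4Continuum.HistoryRegionTemplates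
open Summit.QuantumFields.BalabanUV.T4Continuum.HistoryCaps
open Summit.QuantumFields.BalabanUV.T4Continuum.HistoryZoneEvolve (cth)
open Literature.MathematicalPhysics.QuantumFieldTheory.Balaban1983to89.B16SProfile (DropCtl)

open Summit.QuantumFields.BalabanUV.T4Continuum.HistoryRealiseCellsRunMultEnd
open Summit.QuantumFields.BalabanUV.T4Continuum.HistoryRealiseCellsRunMultP
open Summit.QuantumFields.BalabanUV.T4Continuum.HistoryRealiseCellsRunMultEndP
open Summit.QuantumFields.BalabanUV.T4Continuum.HistoryRealiseCellsRunMultEndPD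
open Summit.QuantumFields.BalabanUV.T4Continuum.HistoryRealiseCellsRunMultEndPTwin

-- letters of the twin bound (as opened in `HistoryAssemblyMultInstance`)
open Finset
open Literature.MathematicalPhysics.QuantumFieldTheory.Balaban1983to89.B13ScaleTransfer (Pt FaceConnected)
open T4PersistenceDictionary T4PrintedShapeBanking T4TaggedShapeBanking T4PartnerMultiplicity T4BranchingRecordsGas
open Summit.QuantumFields.BalabanUV.T4Continuum.ZoneTorus
open Summit.QuantumFields.BalabanUV.T4Continuum.HistoryAdmissible
open Summit.QuantumFields.BalabanUV.T4Continuum.HistoryJoins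
open Summit.QuantumFields.BalabanUV.T4Continuum.HistoryJoinsAdm
open Summit.QuantumFields.BalabanUV.T4Continuum.HistoryAssemblyMultLetters
open Summit.QuantumFields.BalabanUV.T4Continuum.HistoryJoinsTemplates
open Summit.QuantumFields.BalabanUV.T4Continuum.HistoryJoinsPlacedZone
open Summit.QuantumFields.BalabanUV.T4Continuum.HistoryJoinsPlacedValue
open Summit.QuantumFields.BalabanUV.T4Continuum.HistoryJoinsPlacedTwin
open Summit.QuantumFields.BalabanUV.T4Continuum.HistorySiblingEntropyBridge
open Summit.QuantumFields.BalabanUV.T4Continuum.HistoryZoneMassLawLevels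
open Summit.QuantumFields.BalabanUV.T4Continuum.HistoryRenewalsCost
open Summit.QuantumFields.BalabanUV.T4Continuum.HistoryRealiseCellsRunMultEndPDTwin
open Literature.MathematicalPhysics.QuantumFieldTheory.Balaban1983to89
open T4Continuum T4PrintedShapeBanking T4CanonicalMenus
open Summit.QuantumFields.BalabanUV.T4Continuum.CountThresholdUniform
open Summit.QuantumFields.BalabanUV.T4Continuum.HistoryConstants
open Summit.QuantumFields.BalabanUV.T4Continuum.HistoryRealiseCellsRunPinnedT3bPTwin
open Summit.QuantumFields.BalabanUV.T4Continuum.HistoryRealiseCellsRunApexT3b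

namespace Summit.QuantumFields.BalabanUV.T4Continuum.HistoryRealiseCellsRunHeadlineT3bPTwin

noncomputable section

/-! ## §1 The count-road witness WITH the twin bound at a class-linear constant `Θ₀` -/

section Witness

variable {F : T4Family} {G : Type*} [GaugeGroup G] [MeasurableSpace G] [HaarData G] [RegularGaugeGroup G]

/-- **THE COUNT-ROAD WITNESS OF A STRING AT A CLASS-LINEAR CONSTANT `Θ₀`** (HYPOTHESIS SHAPE — NOTHING asserted):
`HistoryRealiseCellsRunApexT3b.CountRoadWitnessT3b` (END v3's term data, H3, E1∕E2, (B) side, NE7c, NE7, rates) EXTENDED by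
ONE field — the twin bound of row S6g′ at `Θ₀` along the run (END v3.2′'s `htwin`, row S12o (iii)), on the witness' own
`K₀ ∕ T ∕ R ∕ ped ∕ liveC`.  `Type`-valued like its parent; consumed only under `Nonempty` inside a binder. [folklore] -/
structure CountRoadWitnessT3bTwin (D : FiniteEpsData F G) (C : T4PrintedShapeBanking.Consts) (O : PrintedO1s) (rr d n : ℕ)
    (hn : 0 < n) (Θ₀ : ℝ) (g₀ : ℕ → ℝ) (os : List (ULoop F)) (ι α π : Type) [DecidableEq ι] [DecidableEq α]
    [DecidableEq π] extends CountRoadWitnessT3b D C O rr d n hn g₀ os ι α π where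
  /-- row S12o (iii), DISPLAYED: the twin bound of row S6g′ at the class-linear constant `Θ₀` along the run -/
  twin : ∀ K, K₀ ≤ K → ∀ τ ∈ T K, ∀ c ∈ liveC K τ,
    ConsistentTLE Prod.fst C K (R K) ((ped K τ).genT c) → (ped K τ).step c ≤ K →
    ∀ (Mz Dz : ℕ) (c₀ : TCell d (n * F.L ^ K) × Template d Mz)
      (ρ : (Addr Dz → TCell d (n * F.L ^ K) × Template d Mz) → ℕ) (z : TCell d (n * F.L ^ K) × Template d Mz),
    ((HistoryJoinsAdm.S (zoneP n F.L K (levelOf (runProfile F.L R K) K) 32 c₀) ρ c₀ PEv.step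
        ((ped K τ).sortR.gen c) z).card : ℝ) ≤
      Real.exp (Θ₀ * bsum (fun b => ((b.fat : ℕ) : ℝ) + 1) ((ped K τ).gen c) +
          8 / C.E₂ * totalCostT Prod.fst C K (R K) ((ped K τ).genT c)) *
        (((F.L : ℝ) ^ d) * Real.exp 4) ^ partnerAges PEv.step ((ped K τ).gen c)

end Witness

/-! ## §2 The apex input and the headline, uniformly in `Θ₀` -/

section Under

variable {F : T4Family} {G : Type*} [GaugeGroup G] [MeasurableSpace G] [HaarData G] [RegularGaugeGroup G]

/-- **ROW NE7b AT THE APEX OVER THE GENERIC END v3.2′: `HybridNE7Under D (BetaPertHyp D.βfun)` FROM THE PREFIXED WITNESS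
HYPOTHESIS AT ANY CLASS-LINEAR CONSTANT `Θ₀`, NO DEMAND ON PRINT's CONSTANTS, NO STRIDE ∕ DECAY ARITHMETIC.**  For data with
measurable averaging maps, the datum's sign conventions and the constants-only side conditions (any positive slack `θ`, any
`Θ₀`; inhabited — `exists_consts_countRoadT3bPTwin`): if `ForSmallCouplings D (g₀ ↦ ∀ os, a CountRoadWitnessT3bTwin at Θ₀)`
(H3 + representation + (B)-side data + NE7c + NE7 + rates + the twin bound at `Θ₀` — DISPLAYED, none in print, none a
theorem of the tree), then the apex input holds; thresholds `min γ₁ γ₂`, `min g₁ g₂` of the pinned generic END (file 1,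
consuming `(B)`, `BetaPertHyp` BY NAME and paying the level of `Θ₀ + 8·2^d·log(2d+1)` inside its `g₁`) and of the hypothesis.
NE7b NOT proved. [folklore] -/
theorem hybridNE7Under_of_countRoadT3bPTwin_fsc (D : FiniteEpsData F G) (hM : D.AvgMeasurable)
    (hsign : B16.SignConventions D.C)
    {C : T4PrintedShapeBanking.Consts} {O : PrintedO1s}
    {rr : ℕ} {β₀ : ℝ} (h : ThresholdOK C F.L rr β₀) (hμ : 0 < C.μ) (d n : ℕ)
    (hκ₁ : (d : ℝ) * Real.log F.L + 2 * Real.log 2 ≤ C.κ₁) (hE₀ : Real.log (2 + birthMass C) ≤ C.E₀)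
    (hA₀ : 1 ≤ C.A₀) (hβ₀ : 0 < β₀) (hLβ : (F.L : ℝ) * β₀ ≤ 1) (hn₁ : 13 ≤ C.n₁) (hn : 0 < n)
    {θ : ℝ} (hθ : 0 < θ) (hslack : C.a + θ ≤ O.γ₀ * O.A₁ ^ 2 / 2) (Θ₀ : ℝ)
    (hData : T4ContinuumYM4Torus.ForSmallCouplings D fun g₀ => ∀ os : List (ULoop F),
        ∃ (ι α π : Type) (_ : DecidableEq ι) (_ : DecidableEq α) (_ : DecidableEq π),
          Nonempty (CountRoadWitnessT3bTwin D C O rr d n hn Θ₀ g₀ os ι α π)) :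
    T4ApexHybrid.HybridNE7Under D (BetaPertHyp D.βfun) := by
  intro hB hβ
  obtain ⟨γ₁, hγ₁, H⟩ := hybridNE7_of_realisedDomainsRun_pinnedT3bPD_of_twin D hB hβ hsign h hμ d n hκ₁ hE₀ hA₀ hβ₀ hLβ
    hn₁ hn hθ hslack Θ₀
  obtain ⟨γ₂, hγ₂, H₂⟩ := hData
  refine ⟨min γ₁ γ₂, lt_min hγ₁ hγ₂, fun γ hγ hγle => ?_⟩
  obtain ⟨g₁, hg₁, Hg⟩ := H γ hγ (hγle.trans (min_le_left _ _))
  obtain ⟨g₂, hg₂, Hg₂⟩ := H₂ γ hγ (hγle.trans (min_le_right _ _))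
  refine ⟨min g₁ g₂, lt_min hg₁ hg₂, fun g hg hgle g₀ ht os => ?_⟩
  obtain ⟨Em, -, HE⟩ := Hg g hg (hgle.trans (min_le_left _ _))
  obtain ⟨ι, α, π, _, _, _, ⟨X⟩⟩ := Hg₂ g hg (hgle.trans (min_le_right _ _)) g₀ ht os
  have hm : ∀ K o, Measurable ((D.scheme g₀).obs K o) := fun K o => D.measurable_avgObs hM K o
  have h1 : ∀ K o U, |(D.scheme g₀).obs K o U| ≤ 1 := fun K o U => D.abs_avgObs_le_one K o U
  obtain ⟨K₁, K₂, hK₁, hH⟩ := HE g₀ ht X.l₀ X.vol X.K₀ X.T X.A X.A' X.shA X.shB X.dead X.dead' X.nup X.mup X.Nup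
    X.Cc X.Rr X.CcRec X.RrRec X.ν X.u X.s₂ X.q₀ X.r X.s X.Wsh (fun K => T4GenFunBounds.prodObs (D.scheme g₀) K os) 1
    (fun K => T4GenFunBounds.measurable_prodObs (D.scheme g₀) hm K os)
    (fun K U => T4GenFunBounds.abs_prodObs_le_one (D.scheme g₀) h1 K os U)
    (fun K t ht hK => (X.reprA K t ht hK).le) (fun K t ht hK => (X.reprB K t ht hK).le) X.c₀ X.n₁ X.c₀_pos X.floor
    X.floor' X.sites X.sites' X.Nup_nonneg X.nup_bd X.mup_bd X.R X.isRj X.one_le_R X.ped X.cellP X.liveC X.Zd X.realised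
    X.step_le X.disjointJoins X.boxedBirths X.twin X.κ X.κ' X.cost_le X.cost_le' X.FcM X.RfM X.FcM' X.RfM' X.priceM
    X.priceM' X.upM X.deadM_nonneg X.resumM X.FM_nonneg X.upM' X.deadM'_nonneg X.resumM' X.FM'_nonneg X.shell X.budget
    X.sum_r X.sum_u X.sum_s X.sum_s₂
  exact ⟨X.l₀, X.vol, K₁ + K₂, X.l₀_pos, X.vol_pos, stringHybridNE7_of_hybridNE7T3b D X.toCountRoadWitnessT3b hK₁ hH⟩

/-- **The every-`γ, g > 0` form** (a witness for EVERY positive-coupling tuned run and every string; thresholds `1, 1` on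
the hypothesis' side): corollary of `hybridNE7Under_of_countRoadT3bPTwin_fsc`.  CONDITIONAL; NE7b NOT proved. [folklore] -/
theorem hybridNE7Under_of_countRoadT3bPTwin (D : FiniteEpsData F G) (hM : D.AvgMeasurable)
    (hsign : B16.SignConventions D.C)
    {C : T4PrintedShapeBanking.Consts} {O : PrintedO1s}
    {rr : ℕ} {β₀ : ℝ} (h : ThresholdOK C F.L rr β₀) (hμ : 0 < C.μ) (d n : ℕ)
    (hκ₁ : (d : ℝ) * Real.log F.L + 2 * Real.log 2 ≤ C.κ₁) (hE₀ : Real.log (2 + birthMass C) ≤ C.E₀)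
    (hA₀ : 1 ≤ C.A₀) (hβ₀ : 0 < β₀) (hLβ : (F.L : ℝ) * β₀ ≤ 1) (hn₁ : 13 ≤ C.n₁) (hn : 0 < n)
    {θ : ℝ} (hθ : 0 < θ) (hslack : C.a + θ ≤ O.γ₀ * O.A₁ ^ 2 / 2) (Θ₀ : ℝ)
    (hData : ∀ (γ g : ℝ) (g₀ : ℕ → ℝ), 0 < γ → 0 < g → D.Tuned γ g g₀ →
      ∀ os : List (ULoop F), ∃ (ι α π : Type) (_ : DecidableEq ι) (_ : DecidableEq α) (_ : DecidableEq π),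
        Nonempty (CountRoadWitnessT3bTwin D C O rr d n hn Θ₀ g₀ os ι α π)) :
    T4ApexHybrid.HybridNE7Under D (BetaPertHyp D.βfun) :=
  hybridNE7Under_of_countRoadT3bPTwin_fsc D hM hsign h hμ d n hκ₁ hE₀ hA₀ hβ₀ hLβ hn₁ hn hθ hslack Θ₀
    ⟨1, one_pos, fun γ hγ _ => ⟨1, one_pos, fun g hg _ g₀ ht => hData γ g g₀ hγ hg ht⟩⟩

/-- **COROLLARY: EXISTENCE** of the continuum limit of every joint expectation of unit-scale averaged loop variables along
the full sequence of spacings, under the prefix (`D.ym4_torus_continuum_limit_exists`), GIVEN the prefixed witnesses at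
`Θ₀` — by `T4ApexHybrid.limit_exists_of_hybridNE7Under`.  CONDITIONAL; NE7b NOT proved. [folklore] -/
theorem limit_exists_of_countRoadT3bPTwin_fsc (D : FiniteEpsData F G) (hM : D.AvgMeasurable)
    (hsign : B16.SignConventions D.C)
    {C : T4PrintedShapeBanking.Consts} {O : PrintedO1s}
    {rr : ℕ} {β₀ : ℝ} (h : ThresholdOK C F.L rr β₀) (hμ : 0 < C.μ) (d n : ℕ)
    (hκ₁ : (d : ℝ) * Real.log F.L + 2 * Real.log 2 ≤ C.κ₁) (hE₀ : Real.log (2 + birthMass C) ≤ C.E₀)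
    (hA₀ : 1 ≤ C.A₀) (hβ₀ : 0 < β₀) (hLβ : (F.L : ℝ) * β₀ ≤ 1) (hn₁ : 13 ≤ C.n₁) (hn : 0 < n)
    {θ : ℝ} (hθ : 0 < θ) (hslack : C.a + θ ≤ O.γ₀ * O.A₁ ^ 2 / 2) (Θ₀ : ℝ)
    (hData : T4ContinuumYM4Torus.ForSmallCouplings D fun g₀ => ∀ os : List (ULoop F),
        ∃ (ι α π : Type) (_ : DecidableEq ι) (_ : DecidableEq α) (_ : DecidableEq π),
          Nonempty (CountRoadWitnessT3bTwin D C O rr d n hn Θ₀ g₀ os ι α π)) :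
    D.ym4_torus_continuum_limit_exists :=
  T4ApexHybrid.limit_exists_of_hybridNE7Under D hM
    (hybridNE7Under_of_countRoadT3bPTwin_fsc D hM hsign h hμ d n hκ₁ hE₀ hA₀ hβ₀ hLβ hn₁ hn hθ hslack Θ₀ hData)

/-- **COROLLARY: UNIQUENESS** of the limit points (`D.ym4_torus_continuum_limit_unique`) under the same displayed data — by
`T4ApexHybrid.limit_unique_of_hybridNE7Under`.  CONDITIONAL; NE7b NOT proved. [folklore] -/
theorem limit_unique_of_countRoadT3bPTwin_fsc (D : FiniteEpsData F G) (hM : D.AvgMeasurable)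
    (hsign : B16.SignConventions D.C)
    {C : T4PrintedShapeBanking.Consts} {O : PrintedO1s}
    {rr : ℕ} {β₀ : ℝ} (h : ThresholdOK C F.L rr β₀) (hμ : 0 < C.μ) (d n : ℕ)
    (hκ₁ : (d : ℝ) * Real.log F.L + 2 * Real.log 2 ≤ C.κ₁) (hE₀ : Real.log (2 + birthMass C) ≤ C.E₀)
    (hA₀ : 1 ≤ C.A₀) (hβ₀ : 0 < β₀) (hLβ : (F.L : ℝ) * β₀ ≤ 1) (hn₁ : 13 ≤ C.n₁) (hn : 0 < n)
    {θ : ℝ} (hθ : 0 < θ) (hslack : C.a + θ ≤ O.γ₀ * O.A₁ ^ 2 / 2) (Θ₀ : ℝ)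
    (hData : T4ContinuumYM4Torus.ForSmallCouplings D fun g₀ => ∀ os : List (ULoop F),
        ∃ (ι α π : Type) (_ : DecidableEq ι) (_ : DecidableEq α) (_ : DecidableEq π),
          Nonempty (CountRoadWitnessT3bTwin D C O rr d n hn Θ₀ g₀ os ι α π)) :
    D.ym4_torus_continuum_limit_unique :=
  T4ApexHybrid.limit_unique_of_hybridNE7Under D hM
    (hybridNE7Under_of_countRoadT3bPTwin_fsc D hM hsign h hμ d n hκ₁ hE₀ hA₀ hβ₀ hLβ hn₁ hn hθ hslack Θ₀ hData)

end Under

section SU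

variable {F : T4Family} {N : ℕ} [NeZero N] {ℰ : LoopAverage (Matrix.specialUnitaryGroup (Fin N) ℂ)}

/-- **THE FOUR T⁴ TARGETS FROM THE COUNT ROAD OVER THE GENERIC END v3.2′**, for (0.4)-block-averaged data on `SU(N)` with a
measurable small-loop average, at any class-linear constant `Θ₀`: `hybridNE7Under_of_countRoadT3bPTwin_fsc` ∘
`T4ApexHybrid.targets_of_hybridNE7Under`.  CONDITIONAL on (B), `BetaPertHyp` (inside the targets' own prefix) and the
displayed prefixed witnesses; NE7b NOT proved. [folklore] -/
theorem targets_of_countRoadT3bPTwin_fsc (D : FiniteEpsData F (Matrix.specialUnitaryGroup (Fin N) ℂ))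
    (hBA : D.IsBlockAveraged ℰ) (hE : ℰ.MeasurableE) (hsign : B16.SignConventions D.C)
    {C : T4PrintedShapeBanking.Consts} {O : PrintedO1s}
    {rr : ℕ} {β₀ : ℝ} (h : ThresholdOK C F.L rr β₀) (hμ : 0 < C.μ) (d n : ℕ)
    (hκ₁ : (d : ℝ) * Real.log F.L + 2 * Real.log 2 ≤ C.κ₁) (hE₀ : Real.log (2 + birthMass C) ≤ C.E₀)
    (hA₀ : 1 ≤ C.A₀) (hβ₀ : 0 < β₀) (hLβ : (F.L : ℝ) * β₀ ≤ 1) (hn₁ : 13 ≤ C.n₁) (hn : 0 < n)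
    {θ : ℝ} (hθ : 0 < θ) (hslack : C.a + θ ≤ O.γ₀ * O.A₁ ^ 2 / 2) (Θ₀ : ℝ)
    (hData : T4ContinuumYM4Torus.ForSmallCouplings D fun g₀ => ∀ os : List (ULoop F),
        ∃ (ι α π : Type) (_ : DecidableEq ι) (_ : DecidableEq α) (_ : DecidableEq π),
          Nonempty (CountRoadWitnessT3bTwin D C O rr d n hn Θ₀ g₀ os ι α π)) :
    D.ym4_torus_continuum_limit_exists ∧ D.ym4_torus_continuum_limit_unique ∧
      D.limit_reflectionPositive ∧ D.limit_torusCovariant :=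
  T4ApexHybrid.targets_of_hybridNE7Under hBA hE
    (hybridNE7Under_of_countRoadT3bPTwin_fsc D (hBA.avgMeasurable hE) hsign h hμ d n hκ₁ hE₀ hA₀ hβ₀ hLβ hn₁ hn hθ hslack Θ₀ hData)

/-- **THE HEADLINE PREDICATE FROM THE COUNT ROAD OVER THE GENERIC END v3.2′, UNIFORMLY IN THE CLASS-LINEAR CONSTANT**:
`T4ContinuumYM4Torus.ContinuumYM4Torus D` for (0.4)-block-averaged data on `SU(N)` with a measurable small-loop average, GIVEN
the two pins `(B) = B16.EndStatementBPrinted D.C` and `BetaPertHyp D.βfun` BY NAME, the datum's sign conventions, the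
INHABITED constants-only side conditions (any positive slack, any `Θ₀`; `exists_consts_countRoadT3bPTwin`), and a
`CountRoadWitnessT3bTwin` at `Θ₀` for all small-coupling tuned runs and every loop string (`targets_of_countRoadT3bPTwin_fsc` ∘
`T4ContinuumYM4Torus.continuumYM4Torus_of_targets`).  The headline of record (v1.1, p224237) is NOT superseded: this is its
`Θ₀`-uniform sibling (row S12o is kernel-invisible at the headline — only `g₁` depends on `Θ₀`).  NE7b NOT proved; count
0∕9. [folklore] -/
theorem continuumYM4Torus_of_countRoadT3bPTwin_fsc (D : FiniteEpsData F (Matrix.specialUnitaryGroup (Fin N) ℂ))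
    (hBA : D.IsBlockAveraged ℰ) (hE : ℰ.MeasurableE)
    (hB : B16.EndStatementBPrinted D.C) (hβ : BetaPertHyp D.βfun) (hsign : B16.SignConventions D.C)
    {C : T4PrintedShapeBanking.Consts} {O : PrintedO1s}
    {rr : ℕ} {β₀ : ℝ} (h : ThresholdOK C F.L rr β₀) (hμ : 0 < C.μ) (d n : ℕ)
    (hκ₁ : (d : ℝ) * Real.log F.L + 2 * Real.log 2 ≤ C.κ₁) (hE₀ : Real.log (2 + birthMass C) ≤ C.E₀)
    (hA₀ : 1 ≤ C.A₀) (hβ₀ : 0 < β₀) (hLβ : (F.L : ℝ) * β₀ ≤ 1) (hn₁ : 13 ≤ C.n₁) (hn : 0 < n)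
    {θ : ℝ} (hθ : 0 < θ) (hslack : C.a + θ ≤ O.γ₀ * O.A₁ ^ 2 / 2) (Θ₀ : ℝ)
    (hData : T4ContinuumYM4Torus.ForSmallCouplings D fun g₀ => ∀ os : List (ULoop F),
        ∃ (ι α π : Type) (_ : DecidableEq ι) (_ : DecidableEq α) (_ : DecidableEq π),
          Nonempty (CountRoadWitnessT3bTwin D C O rr d n hn Θ₀ g₀ os ι α π)) :
    T4ContinuumYM4Torus.ContinuumYM4Torus D :=
  T4ContinuumYM4Torus.continuumYM4Torus_of_targets hB hβ
    (targets_of_countRoadT3bPTwin_fsc D hBA hE hsign h hμ d n hκ₁ hE₀ hA₀ hβ₀ hLβ hn₁ hn hθ hslack Θ₀ hData)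

end SU

/-! ## §3 The constants side is inhabited, for every `Θ₀` -/

section Consts

/-- **THE CONSTANTS-SIDE ANTECEDENT OF THE `Θ₀`-UNIFORM HEADLINE IS INHABITED** — for every positive printed `O`, every family
`F`, every `d rr` (`n := 1`): a record `C`, a `β₀` and a positive slack `θ` meeting EVERY constants-side binder of
`hybridNE7Under_of_countRoadT3bPTwin_fsc` ∕ `continuumYM4Torus_of_countRoadT3bPTwin_fsc` (the parameter `Θ₀` carries no
condition) — BY NAME from leaf-08 gen 7's after-column census `HistoryConstantsSlackT3bP.END3P_consts_of_pos` at `L := F.L`,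
its `Dominates` ∕ `E₂`∕`E₃` ∕ stride ∕ decay ∕ level conjuncts dropped (no longer antecedents). [folklore] -/
theorem exists_consts_countRoadT3bPTwin {O : PrintedO1s} (hO : O.Pos) (F : T4Family) (d rr : ℕ) :
    ∃ (C : T4PrintedShapeBanking.Consts) (β₀ θ : ℝ) (n : ℕ),
      ThresholdOK C F.L rr β₀ ∧ 0 < C.μ ∧
      (d : ℝ) * Real.log F.L + 2 * Real.log 2 ≤ C.κ₁ ∧ Real.log (2 + birthMass C) ≤ C.E₀ ∧
      1 ≤ C.A₀ ∧ 0 < β₀ ∧ (F.L : ℝ) * β₀ ≤ 1 ∧ 13 ≤ C.n₁ ∧ 0 < n ∧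
      0 < θ ∧ C.a + θ ≤ O.γ₀ * O.A₁ ^ 2 / 2 := by
  obtain ⟨C, β₀, θ, x, sS, θc, h, -, hμ, hκ₁, hE₀, hA₀, hn₁, -, -, hβ₀, hLβ, hθ, hslack, -, -, -, -, -, -, -, -⟩ :=
    HistoryConstantsSlackT3bP.END3P_consts_of_pos hO d (HistoryFlow.two_le_L F) rr
  exact ⟨C, β₀, θ, 1, h, hμ, hκ₁, hE₀, hA₀, hβ₀, hLβ, hn₁, one_pos, hθ, hslack⟩

end Consts

end

end Summit.QuantumFields.BalabanUV.T4Continuum.HistoryRealiseCellsRunHeadlineT3bPTwin
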